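import Summits.MatrixMultiplication.OmegaCensus.STPP222NeverBeatsAnyGroup

/-!
# ω-census (STPP census): SMALL BLOCKS NEVER BEAT — STPP families of sets of size `≤ 2` in any finite group

HONEST FRAMING (pub-omega census; verbatim): lottery ticket; floor = certified bounds/negative ranges.
Census STRUCTURE (seat pub-omega-stpp-1 gen 25, 2026-08-27), family (b2), STRUCTURE N1/Q1 (why no small group carries a beating STPP
family).  Nothing here is progress on `ω`; on the contrary, the theorem says that a whole construction class can never certify `ω < 3`.

## The theorem

Let `(Aᵢ, Bᵢ, Cᵢ)_{i<k}` satisfy CKSU's simultaneous triple product property (Def. 5.1) in a finite group `G`, with every set of size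
`1` or `2` (blocks `(aᵢ, bᵢ, cᵢ) ∈ {1,2}³`).  Then the family NEVER BEATS THE SUM OF CUBES:
`Σᵢ aᵢbᵢcᵢ ≤ Σ_χ d_χ³` (`volume_le_charDegreePowSum_three`, any finite group), and `Σᵢ aᵢbᵢcᵢ ≤ |H|` for abelian `H`
(`volume_le_card_of_card_le_two`, the tree's additive `IsSTPP`).  So CKSU Thm 5.5 (`Σᵢ (aᵢbᵢcᵢ)^{ω/3} ≤ Σ_χ d_χ^ω`) yields nothing
below `ω = 3` from sets of size `≤ 2`, whatever the group and the number of triples.  This extends the cube theorem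
(`STPP222NeverBeats.lean`, `STPP222NeverBeatsAnyGroup.lean`: all blocks `(2,2,2)`) to all `{1,2}`-blocks.

## Proof

Filter N10 (`CubeNB.n9`, any-group form `CubeNB.n10Mul`): `Σᵢ aᵢbᵢ + Σᵢ bᵢcᵢ ≤ n + b_j` for every block `j` (`n = |G|`).  For a
`{1,2}`-block, `ab + bc = abc + b·(a + c − ac)` and `a + c − ac ∈ {0, 1}` vanishes iff `a = c = 2` (§1).  Hence if some block `j` has
`(a_j, c_j) ≠ (2, 2)` then `Σ abc + b_j ≤ Σ ab + Σ bc ≤ n + b_j`, i.e. `Σ abc ≤ n`; otherwise every block has `a = c = 2`, and the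
rotated reading `(B, C, A)` (`stpp_rotate` / `simultaneousTPP_rotate`) forces `b = 2` the same way (or `Σ abc ≤ n`); a family of
cubes has `8k ≤ |H|` (abelian, `CubeNB.eight_mul_le_card`) resp. `8k ≤ Σ d³` (`CubeNB.eight_mul_le_charDegreePowSum_three`).
Finally `|G| ≤ Σ_χ d_χ³` (`= |G|` for commutative `G`, `≥ |G| + 4` otherwise: `CubeNB.card_add_four_le_charDegreePowSum_three`).

References: H. Cohn, R. Kleinberg, B. Szegedy, C. Umans, FOCS 2005 (arXiv:math/0511460), Def. 5.1, Thm. 5.5.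
-/

open Finset

namespace Summit.MatrixMultiplication.OmegaCensus.CubeNB

/-! ## §1 The per-block arithmetic of `{1,2}`-blocks -/

/-- For `a, b, c ∈ {1, 2}`: `abc ≤ ab + bc`. [folklore] -/
theorem mul_mul_le_of_le_two {a b c : ℕ} (ha : a ≤ 2) (hc : c ≤ 2) : a * b * c ≤ a * b + b * c := by
  interval_cases a <;> interval_cases c <;> nlinarith

/-- For `a, b, c ∈ {1, 2}` with `(a, c) ≠ (2, 2)`: `abc + b ≤ ab + bc`. [folklore] -/
theorem mul_mul_add_le_of_ne {a b c : ℕ} (ha1 : 1 ≤ a) (ha : a ≤ 2) (hc1 : 1 ≤ c) (hc : c ≤ 2) (hne : ¬(a = 2 ∧ c = 2)) :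
    a * b * c + b ≤ a * b + b * c := by
  interval_cases a <;> interval_cases c <;> omega

/-- The N10 step on numbers: if `Σᵢ aᵢbᵢ + Σᵢ bᵢcᵢ ≤ n + b_j` for all `j`, all entries are in `{1,2}` and `Σ aᵢbᵢcᵢ > n`, then every
block has `a = c = 2`. [folklore] -/
theorem forall_eq_two_of_n10 {k n : ℕ} {a b c : Fin k → ℕ}
    (h12 : ∀ i, (1 ≤ a i ∧ a i ≤ 2) ∧ (1 ≤ b i ∧ b i ≤ 2) ∧ (1 ≤ c i ∧ c i ≤ 2))
    (hn10 : ∀ j, ∑ i, a i * b i + ∑ i, b i * c i ≤ n + b j) (hV : n < ∑ i, a i * b i * c i) :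
    ∀ i, a i = 2 ∧ c i = 2 := by
  intro j
  by_contra hne
  -- termwise `abc ≤ ab + bc`, with slack `≥ b_j` at `j`
  set f : Fin k → ℕ := fun i => a i * b i + b i * c i - a i * b i * c i with hf
  have hsplit : ∀ i, a i * b i + b i * c i = a i * b i * c i + f i := fun i => by
    have := mul_mul_le_of_le_two (b := b i) (h12 i).1.2 (h12 i).2.2.2
    simp only [hf]; omega
  have hfj : b j ≤ f j := by
    have := mul_mul_add_le_of_ne (b := b j) (h12 j).1.1 (h12 j).1.2 (h12 j).2.2.1 (h12 j).2.2.2 hne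
    simp only [hf]; omega
  have hsum : ∑ i, a i * b i + ∑ i, b i * c i = ∑ i, a i * b i * c i + ∑ i, f i := by
    rw [← sum_add_distrib, ← sum_add_distrib]; exact sum_congr rfl fun i _ => hsplit i
  have hfsum : f j ≤ ∑ i, f i := single_le_sum (fun i _ => Nat.zero_le _) (mem_univ j)
  have := hn10 j
  omega

/-! ## §2 Abelian groups (the tree's additive `IsSTPP`) -/

section Abelian

open Literature.Computability.AlgebraicComplexity

variable {H : Type*} [AddCommGroup H] [DecidableEq H] [Fintype H] {k : ℕ} {A B C : Fin k → Finset H}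

/-- If an abelian STPP family of `{1,2}`-blocks has total volume `> |H|`, every block is a cube `(2,2,2)` (N10 in the readings
`(A,B,C)` and `(B,C,A)`). [cite: CohnKleinbergSzegedyUmans2005, Def. 5.1] -/
theorem forall_card_eq_two_of_card_lt_volume (hS : IsSTPP A B C)
    (h12 : ∀ i, (1 ≤ #(A i) ∧ #(A i) ≤ 2) ∧ (1 ≤ #(B i) ∧ #(B i) ≤ 2) ∧ (1 ≤ #(C i) ∧ #(C i) ≤ 2))
    (hV : Fintype.card H < ∑ i, #(A i) * #(B i) * #(C i)) : ∀ i, #(A i) = 2 ∧ #(B i) = 2 ∧ #(C i) = 2 := by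
  have hA : ∀ i, (A i).Nonempty := fun i => card_pos.1 (h12 i).1.1
  have hB : ∀ i, (B i).Nonempty := fun i => card_pos.1 (h12 i).2.1.1
  have hC : ∀ i, (C i).Nonempty := fun i => card_pos.1 (h12 i).2.2.1
  have hAC : ∀ i, #(A i) = 2 ∧ #(C i) = 2 :=
    forall_eq_two_of_n10 (a := fun i => #(A i)) (b := fun i => #(B i)) (c := fun i => #(C i)) h12 (n9 hS hA hC) hV
  -- rotated reading `(B, C, A)`: volume `Σ bca = Σ abc`
  have h12' : ∀ i, (1 ≤ #(B i) ∧ #(B i) ≤ 2) ∧ (1 ≤ #(C i) ∧ #(C i) ≤ 2) ∧ (1 ≤ #(A i) ∧ #(A i) ≤ 2) :=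
    fun i => ⟨(h12 i).2.1, (h12 i).2.2, (h12 i).1⟩
  have hV' : Fintype.card H < ∑ i, #(B i) * #(C i) * #(A i) := by
    convert hV using 2 with i; ring
  have hBA : ∀ i, #(B i) = 2 ∧ #(A i) = 2 :=
    forall_eq_two_of_n10 (a := fun i => #(B i)) (b := fun i => #(C i)) (c := fun i => #(A i)) h12'
      (n9 (stpp_rotate hS) hB hA) hV'
  exact fun i => ⟨(hAC i).1, (hBA i).1, (hAC i).2⟩

/-- **SMALL BLOCKS NEVER BEAT (abelian).**  An STPP family (CKSU Def. 5.1, the tree's `IsSTPP`) in a finite abelian group `H` with every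
set of size `1` or `2` has total volume `Σᵢ |Aᵢ||Bᵢ||Cᵢ| ≤ |H|`: it never beats the sum of cubes. [cite: CohnKleinbergSzegedyUmans2005, Def. 5.1] -/
theorem volume_le_card_of_card_le_two (hS : IsSTPP A B C)
    (h12 : ∀ i, (1 ≤ #(A i) ∧ #(A i) ≤ 2) ∧ (1 ≤ #(B i) ∧ #(B i) ≤ 2) ∧ (1 ≤ #(C i) ∧ #(C i) ≤ 2)) :
    ∑ i, #(A i) * #(B i) * #(C i) ≤ Fintype.card H := by
  by_contra hlt
  push Not at hlt
  have hc := forall_card_eq_two_of_card_lt_volume hS h12 hlt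
  have h8 := eight_mul_le_card hS hc
  have hV : ∑ i, #(A i) * #(B i) * #(C i) = 8 * k := by
    rw [sum_congr rfl fun i _ => by rw [(hc i).1, (hc i).2.1, (hc i).2.2]]
    simp [mul_comm]
  omega

/-- `ZMod m` instance. [cite: CohnKleinbergSzegedyUmans2005, Def. 5.1] -/
theorem volume_le_of_zmod {m k : ℕ} [NeZero m] {A B C : Fin k → Finset (ZMod m)} (hS : IsSTPP A B C)
    (h12 : ∀ i, (1 ≤ #(A i) ∧ #(A i) ≤ 2) ∧ (1 ≤ #(B i) ∧ #(B i) ≤ 2) ∧ (1 ≤ #(C i) ∧ #(C i) ≤ 2)) :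
    ∑ i, #(A i) * #(B i) * #(C i) ≤ m := by
  have := volume_le_card_of_card_le_two hS h12
  rwa [ZMod.card] at this

end Abelian

/-! ## §3 Any finite group (CKSU Def. 5.1 verbatim, `SimultaneousTPP`) -/

section AnyGroup

open Literature.Combinatorics.Additive Literature.RepresentationTheory.FiniteGroups

/-- If an STPP family of `{1,2}`-blocks in a finite group `G` has total volume `> |G|`, every block is a cube `(2,2,2)` (N10 in any group,
two readings). [cite: CohnKleinbergSzegedyUmans2005, Def. 5.1] -/
theorem forall_card_eq_two_of_card_lt_volume_mul {G : Type*} [Group G] [DecidableEq G] [Fintype G] {k : ℕ}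
    {A B C : Fin k → Finset G} (h : SimultaneousTPP A B C)
    (h12 : ∀ i, (1 ≤ #(A i) ∧ #(A i) ≤ 2) ∧ (1 ≤ #(B i) ∧ #(B i) ≤ 2) ∧ (1 ≤ #(C i) ∧ #(C i) ≤ 2))
    (hV : Fintype.card G < ∑ i, #(A i) * #(B i) * #(C i)) : ∀ i, #(A i) = 2 ∧ #(B i) = 2 ∧ #(C i) = 2 := by
  have hA : ∀ i, (A i).Nonempty := fun i => card_pos.1 (h12 i).1.1
  have hB : ∀ i, (B i).Nonempty := fun i => card_pos.1 (h12 i).2.1.1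
  have hC : ∀ i, (C i).Nonempty := fun i => card_pos.1 (h12 i).2.2.1
  have hAC : ∀ i, #(A i) = 2 ∧ #(C i) = 2 :=
    forall_eq_two_of_n10 (a := fun i => #(A i)) (b := fun i => #(B i)) (c := fun i => #(C i)) h12 (n10Mul h hA hC) hV
  have h12' : ∀ i, (1 ≤ #(B i) ∧ #(B i) ≤ 2) ∧ (1 ≤ #(C i) ∧ #(C i) ≤ 2) ∧ (1 ≤ #(A i) ∧ #(A i) ≤ 2) :=
    fun i => ⟨(h12 i).2.1, (h12 i).2.2, (h12 i).1⟩
  have hV' : Fintype.card G < ∑ i, #(B i) * #(C i) * #(A i) := by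
    convert hV using 2 with i; ring
  have hBA : ∀ i, #(B i) = 2 ∧ #(A i) = 2 :=
    forall_eq_two_of_n10 (a := fun i => #(B i)) (b := fun i => #(C i)) (c := fun i => #(A i)) h12'
      (n10Mul (Literature.Barriers.MatrixMultiplication.simultaneousTPP_rotate h) hB hA) hV'
  exact fun i => ⟨(hAC i).1, (hBA i).1, (hAC i).2⟩

/-- In ANY finite group, an STPP family with sets of size `≤ 2` has volume `≤ |G| + 2` (volume `≤ |G|` unless all blocks are cubes,
and `8k ≤ |G| + 2` for cubes, `CubeNB.eight_mul_le_card_add_two`; Kneser-free). [cite: CohnKleinbergSzegedyUmans2005, Def. 5.1] -/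
theorem volume_le_card_add_two_of_card_le_two {G : Type*} [Group G] [DecidableEq G] [Fintype G] {k : ℕ}
    {A B C : Fin k → Finset G} (h : SimultaneousTPP A B C)
    (h12 : ∀ i, (1 ≤ #(A i) ∧ #(A i) ≤ 2) ∧ (1 ≤ #(B i) ∧ #(B i) ≤ 2) ∧ (1 ≤ #(C i) ∧ #(C i) ≤ 2)) :
    ∑ i, #(A i) * #(B i) * #(C i) ≤ Fintype.card G + 2 := by
  by_contra hlt
  push Not at hlt
  have hc := forall_card_eq_two_of_card_lt_volume_mul h h12 (by omega)
  have h8 := eight_mul_le_card_add_two h hc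
  have hV : ∑ i, #(A i) * #(B i) * #(C i) = 8 * k := by
    rw [sum_congr rfl fun i _ => by rw [(hc i).1, (hc i).2.1, (hc i).2.2]]
    simp [mul_comm]
  omega

/-- `|G| ≤ Σ_χ d_χ³` for every finite group (`= |G|` if commutative, `≥ |G| + 4` otherwise). [cite: Serre1977, §2.4 Cor. 2] -/
theorem card_le_charDegreePowSum_three {G : Type} [Group G] [Finite G] : (Nat.card G : ℝ) ≤ charDegreePowSum G 3 := by
  by_cases hcomm : ∀ a b : G, a * b = b * a
  · haveI : IsMulCommutative G := ⟨⟨hcomm⟩⟩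
    rw [charDegreePowSum_of_isMulCommutative]
  · have := card_add_four_le_charDegreePowSum_three hcomm
    linarith

/-- **SMALL BLOCKS NEVER BEAT THE SUM OF CUBES, IN ANY FINITE GROUP.**  If a finite group `G` carries `k` triples of subsets of size
`1` or `2` with CKSU's simultaneous triple product property (Def. 5.1 verbatim), then `Σᵢ |Aᵢ||Bᵢ||Cᵢ| ≤ Σ_χ d_χ³ = charDegreePowSum G 3`;
so CKSU Thm 5.5 certifies no `ω < 3` from such a family.  (Not all cubes: volume `≤ |G| ≤ Σ d³` by N10; all cubes:
`CubeNB.eight_mul_le_charDegreePowSum_three`.) [cite: CohnKleinbergSzegedyUmans2005, Def. 5.1 and Thm. 5.5] -/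
theorem volume_le_charDegreePowSum_three {G : Type} [Group G] [Fintype G] [DecidableEq G] {k : ℕ}
    {A B C : Fin k → Finset G} (h : SimultaneousTPP A B C)
    (h12 : ∀ i, (1 ≤ #(A i) ∧ #(A i) ≤ 2) ∧ (1 ≤ #(B i) ∧ #(B i) ≤ 2) ∧ (1 ≤ #(C i) ∧ #(C i) ≤ 2)) :
    ((∑ i, #(A i) * #(B i) * #(C i) : ℕ) : ℝ) ≤ charDegreePowSum G 3 := by
  by_cases hV : ∑ i, #(A i) * #(B i) * #(C i) ≤ Fintype.card G
  · have h1 : ((∑ i, #(A i) * #(B i) * #(C i) : ℕ) : ℝ) ≤ (Fintype.card G : ℝ) := by exact_mod_cast hV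
    have h2 := card_le_charDegreePowSum_three (G := G)
    rw [Nat.card_eq_fintype_card] at h2
    linarith
  · push Not at hV
    have hc := forall_card_eq_two_of_card_lt_volume_mul h h12 hV
    have hvol : ∑ i, #(A i) * #(B i) * #(C i) = 8 * k := by
      rw [sum_congr rfl fun i _ => by rw [(hc i).1, (hc i).2.1, (hc i).2.2]]
      simp [mul_comm]
    rw [hvol]
    push_cast
    exact eight_mul_le_charDegreePowSum_three h hc

end AnyGroup

end Summit.MatrixMultiplication.OmegaCensus.CubeNB
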